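import Summits.Ventures.LatticeQCDFlow.Scaling.DefectVarianceFloor
import Literature.MathematicalPhysics.QuantumLattice.GaugeGroups

/-!
HONEST FRAMING: exact (Metropolis-corrected) sampling algorithms for lattice gauge theory; figures
of merit are autocorrelation/cost numbers at stated couplings and volumes; no continuum-physics
claim.

# DefectVarianceFloorSUN — THE DEFECT SPECIFIC-HEAT FLOOR IS STRICTLY POSITIVE FOR EVERY
# NON-TRIVIAL CHARACTER, AND EXPLICIT FOR `SU(N)`: `Var_Haar(Re tr) = 1/2` (`N ≥ 3`), `1` (`N = 2`)
# (lean-1 GEN-11, ours; supplement to the five-part series `TiltedHeatBath` … `DefectVarianceFloor`)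

Venture-side (OURS). Cell `lqcd-flow` (pub-lqcd), unit `pub-lqcd-lean-1-g11`, 2026-08-23.

* §1 `haarVar_re_trace_pos` — for a compact group `G` and a continuous matrix representation `ρ`
  whose character is not constant (`∃ g, Re tr ρ(g) ≠ Re tr ρ(1)`), `Var_Haar(Re tr ρ) > 0` (Haar
  charges open sets; a continuous function vanishing a.e. vanishes); hence the constant of the defect
  floor `e^{−8N(d−1)B} · #D/(8d(d−1)+1) · Var_Haar(Re tr ρ)` is STRICTLY POSITIVE for every non-empty
  defect (`defectFloorConst_pos`) — the (DVF) constant `K` of theory2 item 132 is non-degenerate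
  exactly under the guard `∃ g, Re tr ρ(g) ≠ N` of the venture's repaired conjectures (U′-R)/(U″-R).
* §2 `SU(N)`, fundamental representation: `Var_Haar(Re tr) = ∫ (Re tr g)² dg = 1/2` for `N ≥ 3` and
  `= 1` for `SU(2)` (lean-2's trace moments `haarSqReTrace_eq_half`, `haarSqReTrace_su2`,
  `integral_re_trace_haar_eq_zero`), so the defect specific-heat floor reads
  `e^{−8N(d−1)B} · #D/(8d(d−1)+1) · 1/2 ≤ Var_{β,u}(S_D)` (`defect_variance_floor_sun`, `N ≥ 3`) and
  `e^{−16(d−1)B} · #D/(8d(d−1)+1) ≤ Var_{β,u}(S_D)` (`defect_variance_floor_su2`).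

Numbers (value-free): `SU(3)`, `d = 4`, `B = 0.05` (β_latt = 6B/… — strong coupling):
`K/#D = e^{−3.6}/194 ≈ 1.4·10⁻⁴`; `SU(2)`, `d = 4`, `B = 0.05`: `e^{−2.4}/97 ≈ 9.4·10⁻⁴`.
NOT CLAIMED: sharpness; other representations' explicit moments.  [folklore] mechanism; new
docking only.
-/

noncomputable section

namespace Summit.Ventures.LatticeQCDFlow.Theory2.DefectFloor

open MeasureTheory ProbabilityTheory Literature.MathematicalPhysics.QuantumFieldTheory
open Literature.MathematicalPhysics.QuantumLattice (fundamentalRep fundamentalRep_apply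
  continuous_fundamentalRep)
open Summit.Ventures.LatticeQCDFlow.TrivializingMaps
open scoped ENNReal

/-! ## §1 Positivity of the Haar variance of a non-constant character -/

section Positivity

variable {N : ℕ} {G : Type*} [Group G] [TopologicalSpace G] [IsTopologicalGroup G]
  [CompactSpace G] [MeasurableSpace G] [BorelSpace G] (ρ : G →* Matrix (Fin N) (Fin N) ℂ)

/-- **A non-constant continuous character has positive Haar variance.** [folklore] -/
theorem haarVar_re_trace_pos (hρ : Continuous ρ) (h : ∃ g : G, (ρ g).trace.re ≠ (ρ 1).trace.re) :
    0 < variance (fun g : G => (ρ g).trace.re) (haarProbability G) := by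
  haveI : (haarProbability G).IsHaarMeasure := Measure.isHaarMeasure_haarMeasure ⊤
  have hφ : Continuous fun g : G => (ρ g).trace.re := Complex.continuous_re.comp hρ.matrix_trace
  set m : ℝ := ∫ g, (ρ g).trace.re ∂haarProbability G with hm
  rw [variance_eq_integral hφ.aemeasurable]
  refine lt_of_le_of_ne (integral_nonneg fun _ => sq_nonneg _) fun h0 => ?_
  have hcont : Continuous fun g : G => ((ρ g).trace.re - m) ^ 2 := (hφ.sub continuous_const).pow 2
  have hint : Integrable (fun g : G => ((ρ g).trace.re - m) ^ 2) (haarProbability G) :=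
    hcont.integrable_of_hasCompactSupport (HasCompactSupport.of_compactSpace _)
  have hae := (integral_eq_zero_iff_of_nonneg (fun _ => sq_nonneg _) hint).1 h0.symm
  have heq : (fun g : G => ((ρ g).trace.re - m) ^ 2) = fun _ => 0 :=
    (Continuous.ae_eq_iff_eq (haarProbability G) hcont continuous_const).1 hae
  obtain ⟨g, hg⟩ := h
  have h1 := congrFun heq g
  have h2 := congrFun heq 1
  simp only [pow_eq_zero_iff, ne_eq, OfNat.ofNat_ne_zero, not_false_eq_true, sub_eq_zero] at h1 h2
  exact hg (h1.trans h2.symm)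

/-- **The defect floor constant is strictly positive** for every non-empty defect and every
representation with a non-constant character. -/
theorem defectFloorConst_pos (hρ : Continuous ρ) (h : ∃ g : G, (ρ g).trace.re ≠ (ρ 1).trace.re)
    {d L : ℕ} {D : Finset (Plaquette d L)} (hD : D.Nonempty) (B : ℝ) :
    0 < Real.exp (-(8 * N * ((d - 1 : ℕ) : ℝ) * B)) * ((D.card : ℝ) / ((8 * d * (d - 1) + 1 : ℕ) : ℝ))
        * variance (fun g : G => (ρ g).trace.re) (haarProbability G) := by
  have hcard : (0 : ℝ) < D.card := by exact_mod_cast hD.card_pos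
  have hC : (0 : ℝ) < ((8 * d * (d - 1) + 1 : ℕ) : ℝ) := by positivity
  exact mul_pos (mul_pos (Real.exp_pos _) (div_pos hcard hC)) (haarVar_re_trace_pos ρ hρ h)

end Positivity

/-! ## §2 `SU(N)` in the fundamental representation: explicit constants -/

section SUN

variable {d L N : ℕ} [NeZero L]

/-- `Var_Haar(Re tr) = 1/2` on `SU(N)`, `N ≥ 3` (fundamental representation). -/
theorem haarVar_re_trace_sun (hN : 3 ≤ N) :
    variance (fun g : Matrix.specialUnitaryGroup (Fin N) ℂ => (fundamentalRep (Fin N) g).trace.re)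
      (haarProbability (Matrix.specialUnitaryGroup (Fin N) ℂ)) = 1 / 2 := by
  haveI : SecondCountableTopology (Matrix (Fin N) (Fin N) ℂ) :=
    inferInstanceAs (SecondCountableTopology (Fin N → Fin N → ℂ))
  haveI : SecondCountableTopology (Matrix.specialUnitaryGroup (Fin N) ℂ) :=
    Topology.IsEmbedding.subtypeVal.secondCountableTopology
  have hφ : Continuous fun g : Matrix.specialUnitaryGroup (Fin N) ℂ =>
      (fundamentalRep (Fin N) g).trace.re :=
    Complex.continuous_re.comp (continuous_fundamentalRep (Fin N)).matrix_trace
  rw [variance_eq_integral hφ.aemeasurable]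
  simp only [fundamentalRep_apply]
  rw [integral_re_trace_haar_eq_zero (by omega : 2 ≤ N)]
  simp only [sub_zero]
  exact haarSqReTrace_eq_half hN

/-- `Var_Haar(Re tr) = 1` on `SU(2)` (fundamental representation). -/
theorem haarVar_re_trace_su2 :
    variance (fun g : Matrix.specialUnitaryGroup (Fin 2) ℂ => (fundamentalRep (Fin 2) g).trace.re)
      (haarProbability (Matrix.specialUnitaryGroup (Fin 2) ℂ)) = 1 := by
  haveI : SecondCountableTopology (Matrix (Fin 2) (Fin 2) ℂ) :=
    inferInstanceAs (SecondCountableTopology (Fin 2 → Fin 2 → ℂ))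
  haveI : SecondCountableTopology (Matrix.specialUnitaryGroup (Fin 2) ℂ) :=
    Topology.IsEmbedding.subtypeVal.secondCountableTopology
  have hφ : Continuous fun g : Matrix.specialUnitaryGroup (Fin 2) ℂ =>
      (fundamentalRep (Fin 2) g).trace.re :=
    Complex.continuous_re.comp (continuous_fundamentalRep (Fin 2)).matrix_trace
  rw [variance_eq_integral hφ.aemeasurable]
  simp only [fundamentalRep_apply]
  rw [integral_re_trace_haar_eq_zero (le_refl 2)]
  simp only [sub_zero]
  exact haarSqReTrace_su2

/-- **THE DEFECT SPECIFIC-HEAT FLOOR FOR `SU(N)`, `N ≥ 3`, FUNDAMENTAL REPRESENTATION.**  For every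
`d`, `L ≥ 2`, real `β, u` with `|β|, |u| ≤ B` and every defect `D`:
`e^{−8N(d−1)B} · #D/(8d(d−1)+1) · 1/2 ≤ Var[S_D ; (⊗Haar).tilted(−(β S_{Dᶜ} + u S_D))]`. -/
theorem defect_variance_floor_sun (hN : 3 ≤ N) (hL : 2 ≤ L) {β u B : ℝ} (hβ : |β| ≤ B)
    (hu : |u| ≤ B) (D : Finset (Plaquette d L)) :
    Real.exp (-(8 * N * ((d - 1 : ℕ) : ℝ) * B)) * ((D.card : ℝ) / ((8 * d * (d - 1) + 1 : ℕ) : ℝ))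
        * (1 / 2)
      ≤ variance (fun U : GaugeConfig d L (Matrix.specialUnitaryGroup (Fin N) ℂ) =>
            ∑ p ∈ D, ((N : ℝ)
              - (fundamentalRep (Fin N) (plaquetteHolonomy U p.1 p.2.1.1 p.2.1.2)).trace.re))
          ((Measure.pi fun _ : Edge d L => haarProbability (Matrix.specialUnitaryGroup (Fin N) ℂ)).tilted
            fun U => -(β * (∑ p ∈ Dᶜ, ((N : ℝ)
                - (fundamentalRep (Fin N) (plaquetteHolonomy U p.1 p.2.1.1 p.2.1.2)).trace.re))
              + u * (∑ p ∈ D, ((N : ℝ)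
                - (fundamentalRep (Fin N) (plaquetteHolonomy U p.1 p.2.1.1 p.2.1.2)).trace.re)))) := by
  haveI : SecondCountableTopology (Matrix (Fin N) (Fin N) ℂ) :=
    inferInstanceAs (SecondCountableTopology (Fin N → Fin N → ℂ))
  haveI : SecondCountableTopology (Matrix.specialUnitaryGroup (Fin N) ℂ) :=
    Topology.IsEmbedding.subtypeVal.secondCountableTopology
  have h := defect_variance_floor (d := d) (L := L) (fundamentalRep (Fin N)) hL
    (continuous_fundamentalRep (Fin N)) hβ hu D
  rwa [haarVar_re_trace_sun hN] at h

/-- **THE DEFECT SPECIFIC-HEAT FLOOR FOR `SU(2)`** (fundamental representation):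
`e^{−16(d−1)B} · #D/(8d(d−1)+1) ≤ Var[S_D ; (⊗Haar).tilted(−(β S_{Dᶜ} + u S_D))]`. -/
theorem defect_variance_floor_su2 (hL : 2 ≤ L) {β u B : ℝ} (hβ : |β| ≤ B) (hu : |u| ≤ B)
    (D : Finset (Plaquette d L)) :
    Real.exp (-(16 * ((d - 1 : ℕ) : ℝ) * B)) * ((D.card : ℝ) / ((8 * d * (d - 1) + 1 : ℕ) : ℝ))
      ≤ variance (fun U : GaugeConfig d L (Matrix.specialUnitaryGroup (Fin 2) ℂ) =>
            ∑ p ∈ D, ((2 : ℝ)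
              - (fundamentalRep (Fin 2) (plaquetteHolonomy U p.1 p.2.1.1 p.2.1.2)).trace.re))
          ((Measure.pi fun _ : Edge d L => haarProbability (Matrix.specialUnitaryGroup (Fin 2) ℂ)).tilted
            fun U => -(β * (∑ p ∈ Dᶜ, ((2 : ℝ)
                - (fundamentalRep (Fin 2) (plaquetteHolonomy U p.1 p.2.1.1 p.2.1.2)).trace.re))
              + u * (∑ p ∈ D, ((2 : ℝ)
                - (fundamentalRep (Fin 2) (plaquetteHolonomy U p.1 p.2.1.1 p.2.1.2)).trace.re)))) := by
  haveI : SecondCountableTopology (Matrix (Fin 2) (Fin 2) ℂ) :=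
    inferInstanceAs (SecondCountableTopology (Fin 2 → Fin 2 → ℂ))
  haveI : SecondCountableTopology (Matrix.specialUnitaryGroup (Fin 2) ℂ) :=
    Topology.IsEmbedding.subtypeVal.secondCountableTopology
  have h := defect_variance_floor (d := d) (L := L) (fundamentalRep (Fin 2)) hL
    (continuous_fundamentalRep (Fin 2)) hβ hu D
  rw [haarVar_re_trace_su2, mul_one] at h
  have h16 : Real.exp (-(16 * ((d - 1 : ℕ) : ℝ) * B))
      = Real.exp (-(8 * ((2 : ℕ) : ℝ) * ((d - 1 : ℕ) : ℝ) * B)) := by norm_num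
  rw [h16]
  convert h using 2 <;> norm_num

end SUN

end Summit.Ventures.LatticeQCDFlow.Theory2.DefectFloor
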